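import Summits.Ventures.HSemireg.LineLawConverse
import HarnessLib

/-!
# Venture HSemireg — LINE LAW §20, the CLASS LAW for a prime weight pair, sufficiency in kernel form: aligned prime-ideal classes plus an
# auxiliary ideal give an explicit reached datum (ENGINE-W code B, card LINE-LAW-B.md §20)

HONEST FRAMING. Lean index of the computation cell `pub-hsemireg`, widening group ENGINE-W (code B, seat `engine-w-2`, gen 11). RING ∕ IDEAL
ARITHMETIC in Mathlib's `ℤ√m` on top of this lineage's files (`LineLawConverse` and its parents, imported). THEOREM CF⁶ and «reached
weight lines» enter BY VALUE. No abelian variety, sheaf, `Ext` group or semiregularity map is constructed; nothing here says that HC, HC_CM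
or HC_AV holds. Theorems only (0 `def`, 0 named fact, 0 `sorry`).

SOURCE (card `widen/ENGINE-W/out/probe4/LINE-LAW-B.md` v1.27 §20). THEOREM §20 (m < 0 squarefree): a set S of prime weights is factorwise
reachable for some T iff the prime ideals above the p ∈ S can be chosen with ALL classes equal; for a pair (u, v): iff `[𝔭_u] = [𝔮_v]` for some
`𝔮_v ∈ {𝔭_v, 𝔭̄_v}`, and then, with an auxiliary primitive ideal `𝔯` (norm `r`) in the class `−[𝔭_u]`, the datum `T = u v r`, `A` = the CRT
root, `z_v = gen(𝔯𝔭_u)` (norm `T∕v = u r`), `z_u = gen(𝔯𝔮_v)` (norm `T∕u = v r`) is reached. KERNEL FORM of «⇐» with the two class statements as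
Cox-(7.8) ideal relations: `(x₁)·𝔭_u = (y₁)·𝔮_v` («aligned») and `(x₀) = (y₀)·𝔯𝔭_u` («𝔯𝔭_u principal»), `y₀, y₁ ≠ 0`.

WHAT THE KERNEL HOLDS: `pairLaw_reached_of_aligned` («⇐») — under those relations (ideals `(u, −b_u + l)`, `(v, −b_v + l)`, `(r, −b_r + l)` of forms of
discriminant `4m`, `u, v, r > 0` pairwise coprime, `m < 0`) there are ONE integer `A` and primitive `z_u, z_v ∈ ℤ√m` with `N z_u = v·r`,
`N z_v = u·r`, both dividing `A − l`: THEOREM CF⁶'s criterion for the pair `(u, v)` at `T = u v r`. and `pairLaw_aligned_of_reached` («⇒» as a Cox-(7.8) relation: primitive `z_u` (norm `v s`), `z_v` (norm `u s`) dividing one `A − l`, `u, v, s`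
pairwise coprime ⇒ `(z_u)·(u, −A+l) = (z_v)·(v, −A+l)`, i.e. the classes of the primes above `u` and `v` picked by `A` are equal).
NOT HERE: the choice of `𝔯` (every class contains primitive ideals — by value), `s` sharing primes with `u v` in «⇒» (one-sided prime powers),
larger sets than three. Also `rel_chain` and **`tripleLaw_reached_of_aligned`** (§20 «⇐» for a prime TRIPLE: two alignments + the auxiliary
`(x₀) = (y₀)·𝔯𝔮_u𝔮_v` ⇒ one `A` and primitive `z_u, z_v, z_w` of norms `vwr, uwr, uvr` dividing `A − l`). Tier: kernel for §20 on pairs (both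
directions, coprime `s`) and on triples («⇐»), modulo those by-value points.
-/

namespace Summit.Ventures.HSemireg.LineLawPairLaw

open Summit.Ventures.HSemireg.LineLawPrincipalGenus Summit.Ventures.HSemireg.LineLawRamifiedCapture
open Summit.Ventures.HSemireg.LineLawConverse

/-- **§20 «⇐» for a prime pair.** `m < 0`; ideals `𝔭_u = (u, −b_u + l)`, `𝔮_v = (v, −b_v + l)`, `𝔯 = (r, −b_r + l)` with `b² − n·c = m` at each
(`u, v, r > 0` pairwise coprime); ALIGNMENT `(x₁)·𝔭_u = (y₁)·𝔮_v` and AUXILIARY `(x₀) = (y₀)·(𝔯·𝔭_u)` with `y₀, y₁ ≠ 0`. Then for the CRT root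
`A` (`≡ b_u, b_v, b_r`), `𝔯𝔭_u = (u r, −A + l)` and `𝔯𝔮_v = (v r, −A + l)` are principal, giving primitive `z_v` (norm `u r`) and `z_u` (norm
`v r`) dividing the SAME `A − l`: the pair `(u, v)` is reached at `T = u v r`. [kernel] -/
theorem pairLaw_reached_of_aligned {m : ℤ} (hm : m < 0) {u bu cu v bv cv r br cr : ℤ}
    (hu : 0 < u) (hv : 0 < v) (hr : 0 < r)
    (hbu : bu ^ 2 - u * cu = m) (hbv : bv ^ 2 - v * cv = m) (hbr : br ^ 2 - r * cr = m)
    (huv : IsCoprime u v) (hru : IsCoprime r u) (hrv : IsCoprime r v)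
    {x₀ y₀ x₁ y₁ : ℤ√m} (hy₀ : y₀ ≠ 0) (hy₁ : y₁ ≠ 0)
    (halign : Ideal.span {x₁} * Ideal.span {(u : ℤ√m), ⟨-bu, 1⟩} = Ideal.span {y₁} * Ideal.span {(v : ℤ√m), ⟨-bv, 1⟩})
    (haux : Ideal.span {x₀} = Ideal.span {y₀} * (Ideal.span {(r : ℤ√m), ⟨-br, 1⟩} * Ideal.span {(u : ℤ√m), ⟨-bu, 1⟩})) :
    ∃ (A : ℤ) (zu zv : ℤ√m), zu.norm = v * r ∧ zu ∣ (⟨A, -1⟩ : ℤ√m) ∧ IsCoprime zu.re zu.im ∧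
      zv.norm = u * r ∧ zv ∣ (⟨A, -1⟩ : ℤ√m) ∧ IsCoprime zv.re zv.im := by
  haveI : IsDomain (ℤ√m) := Zsqrtd.isDomain_of_neg hm
  -- the common root A ≡ b_u (u), b_v (v), b_r (r)
  have hr_uv : IsCoprime r (u * v) := IsCoprime.mul_right hru hrv
  obtain ⟨A, hAu, hAv, hAr⟩ := crt_three huv hr_uv bu bv br
  have eu : Ideal.span {(u : ℤ√m), ⟨-bu, 1⟩} = Ideal.span {(u : ℤ√m), ⟨-A, 1⟩} := span_pair_congr (dvd_sub_comm.mp hAu)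
  have ev : Ideal.span {(v : ℤ√m), ⟨-bv, 1⟩} = Ideal.span {(v : ℤ√m), ⟨-A, 1⟩} := span_pair_congr (dvd_sub_comm.mp hAv)
  have er : Ideal.span {(r : ℤ√m), ⟨-br, 1⟩} = Ideal.span {(r : ℤ√m), ⟨-A, 1⟩} := span_pair_congr (dvd_sub_comm.mp hAr)
  have hru' : Ideal.span {(r : ℤ√m), ⟨-A, 1⟩} * Ideal.span {(u : ℤ√m), ⟨-A, 1⟩} =
      Ideal.span {((r * u : ℤ) : ℤ√m), ⟨-A, 1⟩} := span_pair_mul_span_pair_coprime hru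
  have hrv' : Ideal.span {(r : ℤ√m), ⟨-A, 1⟩} * Ideal.span {(v : ℤ√m), ⟨-A, 1⟩} =
      Ideal.span {((r * v : ℤ) : ℤ√m), ⟨-A, 1⟩} := span_pair_mul_span_pair_coprime hrv
  have hAru : (r * u : ℤ) ∣ A ^ 2 - m := IsCoprime.mul_dvd hru (dvd_sq_sub_of_root hbr hAr) (dvd_sq_sub_of_root hbu hAu)
  have hArv : (r * v : ℤ) ∣ A ^ 2 - m := IsCoprime.mul_dvd hrv (dvd_sq_sub_of_root hbr hAr) (dvd_sq_sub_of_root hbv hAv)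
  -- (1) 𝔯·𝔭_u is principal: (y₀)·(ru, −A+l) = (x₀)
  have key_v : Ideal.span {y₀} * Ideal.span {((r * u : ℤ) : ℤ√m), ⟨-A, 1⟩} = Ideal.span {x₀} := by
    rw [← hru', ← eu, ← er, ← haux]
  obtain ⟨zv, hzv, hzvd, hzvc⟩ := principal_norm_of_rel hm (mul_pos hr hu) hAru hy₀ key_v
  -- (2) 𝔯·𝔮_v is principal: (y₀ y₁)·(rv, −A+l) = (x₀ x₁)
  have key_u : Ideal.span {y₀ * y₁} * Ideal.span {((r * v : ℤ) : ℤ√m), ⟨-A, 1⟩} = Ideal.span {x₀ * x₁} := by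
    have h1 : Ideal.span {x₁} * (Ideal.span {(r : ℤ√m), ⟨-br, 1⟩} * Ideal.span {(u : ℤ√m), ⟨-bu, 1⟩}) =
        Ideal.span {y₁} * (Ideal.span {(r : ℤ√m), ⟨-br, 1⟩} * Ideal.span {(v : ℤ√m), ⟨-bv, 1⟩}) := by
      calc Ideal.span {x₁} * (Ideal.span {(r : ℤ√m), ⟨-br, 1⟩} * Ideal.span {(u : ℤ√m), ⟨-bu, 1⟩})
          = Ideal.span {(r : ℤ√m), ⟨-br, 1⟩} * (Ideal.span {x₁} * Ideal.span {(u : ℤ√m), ⟨-bu, 1⟩}) := by ring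
        _ = Ideal.span {(r : ℤ√m), ⟨-br, 1⟩} * (Ideal.span {y₁} * Ideal.span {(v : ℤ√m), ⟨-bv, 1⟩}) := by rw [halign]
        _ = Ideal.span {y₁} * (Ideal.span {(r : ℤ√m), ⟨-br, 1⟩} * Ideal.span {(v : ℤ√m), ⟨-bv, 1⟩}) := by ring
    have h2 : Ideal.span {y₀} * (Ideal.span {x₁} * (Ideal.span {(r : ℤ√m), ⟨-br, 1⟩} * Ideal.span {(u : ℤ√m), ⟨-bu, 1⟩})) =
        Ideal.span {x₁} * Ideal.span {x₀} := by rw [haux]; ring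
    rw [h1] at h2
    -- h2 : (y₀) * ((y₁) * (𝔯 * 𝔮_v)) = (x₁) * (x₀)
    rw [← hrv', ← er, ← ev, ← Ideal.span_singleton_mul_span_singleton y₀ y₁, ← Ideal.span_singleton_mul_span_singleton x₀ x₁]
    calc Ideal.span {y₀} * Ideal.span {y₁} * (Ideal.span {(r : ℤ√m), ⟨-br, 1⟩} * Ideal.span {(v : ℤ√m), ⟨-bv, 1⟩})
        = Ideal.span {y₀} * (Ideal.span {y₁} * (Ideal.span {(r : ℤ√m), ⟨-br, 1⟩} * Ideal.span {(v : ℤ√m), ⟨-bv, 1⟩})) := by ring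
      _ = Ideal.span {x₁} * Ideal.span {x₀} := h2
      _ = Ideal.span {x₀} * Ideal.span {x₁} := by ring
  obtain ⟨zu, hzu, hzud, hzuc⟩ := principal_norm_of_rel hm (mul_pos hr hv) hArv (mul_ne_zero hy₀ hy₁) key_u
  exact ⟨A, zu, zv, by rw [hzu]; ring, hzud, hzuc, by rw [hzv]; ring, hzvd, hzvc⟩

/-- **§20 «⇒» for a prime pair, kernel form (the coupling as a Cox-(7.8) relation).** If primitive `z_u` (norm `v·s`) and `z_v` (norm `u·s`)
divide the SAME `A − l` in `ℤ√m` (`u, v, s` pairwise coprime — the case where `s` shares no prime with `u v`), then the ideals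
`𝔞_u(A) = (u, −A + l)` and `𝔞_v(A) = (v, −A + l)` satisfy `(z_u)·𝔞_u(A) = (z_v)·𝔞_v(A)` — i.e. `[𝔞_u(A)] = [𝔞_v(A)]`: the classes of the
primes above `u` and `v` picked out by `A` are EQUAL (alignment). Proof: `(z_u) = (vs, −A+l) = 𝔞_v·𝔞_s`, `(z_v) = (us, −A+l) = 𝔞_u·𝔞_s`
(§11 PROPOSITION + coprime product formula), and `𝔞_u·𝔞_v·𝔞_s` is both `𝔞_u·(z_u)` and `𝔞_v·(z_v)`. [kernel] -/
theorem pairLaw_aligned_of_reached {m u v s A : ℤ} (huv : IsCoprime u v) (hus : IsCoprime u s) (hvs : IsCoprime v s)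
    {zu wu zv wv : ℤ√m} (hzu : zu * wu = ⟨A, -1⟩) (hzv : zv * wv = ⟨A, -1⟩)
    (nzu : zu.norm = v * s) (nzv : zv.norm = u * s) :
    Ideal.span {zu} * Ideal.span {(u : ℤ√m), ⟨-A, 1⟩} = Ideal.span {zv} * Ideal.span {(v : ℤ√m), ⟨-A, 1⟩} := by
  -- the two principal ideals as (n, −A + l)
  have hcu : A ^ 2 - (v * s) * wu.norm = m := by
    have := norm_mul_norm_of_dvd hzu; rw [nzu] at this; linear_combination (-1 : ℤ) * this
  have hcv : A ^ 2 - (u * s) * wv.norm = m := by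
    have := norm_mul_norm_of_dvd hzv; rw [nzv] at this; linear_combination (-1 : ℤ) * this
  have e_u : Ideal.span {((v * s : ℤ) : ℤ√m), ⟨-A, 1⟩} = Ideal.span {zu} :=
    span_eq_of_dvd_of_norm hcu ⟨wu, hzu.symm⟩ (Or.inl nzu)
  have e_v : Ideal.span {((u * s : ℤ) : ℤ√m), ⟨-A, 1⟩} = Ideal.span {zv} :=
    span_eq_of_dvd_of_norm hcv ⟨wv, hzv.symm⟩ (Or.inl nzv)
  -- coprime product formula: (u)(v s) and (v)(u s) are both (u v s, −A + l)
  have p1 : Ideal.span {(u : ℤ√m), ⟨-A, 1⟩} * Ideal.span {((v * s : ℤ) : ℤ√m), ⟨-A, 1⟩} =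
      Ideal.span {((u * (v * s) : ℤ) : ℤ√m), ⟨-A, 1⟩} :=
    span_pair_mul_span_pair_coprime (IsCoprime.mul_right huv hus)
  have p2 : Ideal.span {(v : ℤ√m), ⟨-A, 1⟩} * Ideal.span {((u * s : ℤ) : ℤ√m), ⟨-A, 1⟩} =
      Ideal.span {((v * (u * s) : ℤ) : ℤ√m), ⟨-A, 1⟩} :=
    span_pair_mul_span_pair_coprime (IsCoprime.mul_right huv.symm hvs)
  have e3 : (u * (v * s) : ℤ) = v * (u * s) := by ring
  calc Ideal.span {zu} * Ideal.span {(u : ℤ√m), ⟨-A, 1⟩}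
      = Ideal.span {(u : ℤ√m), ⟨-A, 1⟩} * Ideal.span {((v * s : ℤ) : ℤ√m), ⟨-A, 1⟩} := by rw [e_u, mul_comm]
    _ = Ideal.span {((u * (v * s) : ℤ) : ℤ√m), ⟨-A, 1⟩} := p1
    _ = Ideal.span {((v * (u * s) : ℤ) : ℤ√m), ⟨-A, 1⟩} := by rw [e3]
    _ = Ideal.span {(v : ℤ√m), ⟨-A, 1⟩} * Ideal.span {((u * s : ℤ) : ℤ√m), ⟨-A, 1⟩} := p2.symm
    _ = Ideal.span {zv} * Ideal.span {(v : ℤ√m), ⟨-A, 1⟩} := by rw [e_v, mul_comm]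

/-- Transport of principality along a Cox-(7.8) relation: `(a)·I = (b)·J` and `(c)·J = (d)` give `(a c)·I = (b d)`. [kernel] -/
theorem rel_chain {R : Type*} [CommRing R] {a b c d : R} {I J : Ideal R}
    (h1 : Ideal.span {a} * I = Ideal.span {b} * J) (h2 : Ideal.span {c} * J = Ideal.span {d}) :
    Ideal.span {a * c} * I = Ideal.span {b * d} := by
  rw [← Ideal.span_singleton_mul_span_singleton, ← Ideal.span_singleton_mul_span_singleton, ← h2]
  calc Ideal.span {a} * Ideal.span {c} * I = Ideal.span {c} * (Ideal.span {a} * I) := by ring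
    _ = Ideal.span {c} * (Ideal.span {b} * J) := by rw [h1]
    _ = Ideal.span {b} * (Ideal.span {c} * J) := by ring

/-- **§20 «⇐» for a prime TRIPLE.** `m < 0`; ideals `𝔮_u, 𝔮_v, 𝔮_w, 𝔯` (`(n, −b_n + l)` with `b_n² − n c_n = m`; `u, v, w, r > 0` pairwise coprime);
ALIGNMENT `(x₁)·𝔮_u = (y₁)·𝔮_v`, `(x₂)·𝔮_u = (y₂)·𝔮_w` and AUXILIARY `(x₀) = (y₀)·(𝔯·𝔮_u·𝔮_v)` (the class `−2c`), `y₀, x₁, y₁, y₂ ≠ 0`. Then for the CRT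
root `A` there are primitive `z_u` (norm `v w r`), `z_v` (norm `u w r`), `z_w` (norm `u v r`) dividing the SAME `A − l`: the triple `(u, v, w)` is
reached at `T = u v w r`. [kernel] -/
theorem tripleLaw_reached_of_aligned {m : ℤ} (hm : m < 0) {u bu cu v bv cv w bw cw r br cr : ℤ}
    (hu : 0 < u) (hv : 0 < v) (hw : 0 < w) (hr : 0 < r)
    (hbu : bu ^ 2 - u * cu = m) (hbv : bv ^ 2 - v * cv = m) (hbw : bw ^ 2 - w * cw = m) (hbr : br ^ 2 - r * cr = m)
    (huv : IsCoprime u v) (huw : IsCoprime u w) (hvw : IsCoprime v w) (hru : IsCoprime r u) (hrv : IsCoprime r v) (hrw : IsCoprime r w)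
    {x₀ y₀ x₁ y₁ x₂ y₂ : ℤ√m} (hy₀ : y₀ ≠ 0) (hx₁ : x₁ ≠ 0) (hy₁ : y₁ ≠ 0) (hy₂ : y₂ ≠ 0)
    (h1 : Ideal.span {x₁} * Ideal.span {(u : ℤ√m), ⟨-bu, 1⟩} = Ideal.span {y₁} * Ideal.span {(v : ℤ√m), ⟨-bv, 1⟩})
    (h2 : Ideal.span {x₂} * Ideal.span {(u : ℤ√m), ⟨-bu, 1⟩} = Ideal.span {y₂} * Ideal.span {(w : ℤ√m), ⟨-bw, 1⟩})
    (haux : Ideal.span {x₀} = Ideal.span {y₀} *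
      (Ideal.span {(r : ℤ√m), ⟨-br, 1⟩} * Ideal.span {(u : ℤ√m), ⟨-bu, 1⟩} * Ideal.span {(v : ℤ√m), ⟨-bv, 1⟩})) :
    ∃ (A : ℤ) (zu zv zw : ℤ√m),
      (zu.norm = v * w * r ∧ zu ∣ (⟨A, -1⟩ : ℤ√m) ∧ IsCoprime zu.re zu.im) ∧
      (zv.norm = u * w * r ∧ zv ∣ (⟨A, -1⟩ : ℤ√m) ∧ IsCoprime zv.re zv.im) ∧
      (zw.norm = u * v * r ∧ zw ∣ (⟨A, -1⟩ : ℤ√m) ∧ IsCoprime zw.re zw.im) := by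
  haveI : IsDomain (ℤ√m) := Zsqrtd.isDomain_of_neg hm
  -- common root A ≡ b_u (u), b_v (v), b_w (w), b_r (r)
  obtain ⟨B, hBu, hBv, hBw⟩ := crt_three huv (IsCoprime.mul_right huw.symm hvw.symm) bu bv bw
  have hr_uvw : IsCoprime r (u * v * w) := IsCoprime.mul_right (IsCoprime.mul_right hru hrv) hrw
  obtain ⟨A, hAr, hAB⟩ := crt_pair hr_uvw br B
  have hAu : u ∣ A - bu := by
    have e : A - bu = (A - B) + (B - bu) := by ring
    rw [e]; exact dvd_add ((dvd_mul_of_dvd_left (dvd_mul_right u v) w).trans hAB) hBu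
  have hAv : v ∣ A - bv := by
    have e : A - bv = (A - B) + (B - bv) := by ring
    rw [e]; exact dvd_add ((dvd_mul_of_dvd_left (dvd_mul_left v u) w).trans hAB) hBv
  have hAw : w ∣ A - bw := by
    have e : A - bw = (A - B) + (B - bw) := by ring
    rw [e]; exact dvd_add ((dvd_mul_left w (u * v)).trans hAB) hBw
  -- rewrite the four ideals at the common root
  have eu := span_pair_congr (m := m) (dvd_sub_comm.mp hAu)
  have ev := span_pair_congr (m := m) (dvd_sub_comm.mp hAv)
  have ew := span_pair_congr (m := m) (dvd_sub_comm.mp hAw)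
  have er := span_pair_congr (m := m) (dvd_sub_comm.mp hAr)
  rw [eu] at h1 h2 haux; rw [ev] at h1 haux; rw [ew] at h2; rw [er] at haux
  -- product formulas at the root A
  have P : ∀ {a b : ℤ}, IsCoprime a b → Ideal.span {(a : ℤ√m), ⟨-A, 1⟩} * Ideal.span {(b : ℤ√m), ⟨-A, 1⟩} =
      Ideal.span {((a * b : ℤ) : ℤ√m), ⟨-A, 1⟩} := fun h => span_pair_mul_span_pair_coprime h
  have hA : ∀ {n b c : ℤ}, b ^ 2 - n * c = m → n ∣ A - b → n ∣ A ^ 2 - m := fun hb hd => dvd_sq_sub_of_root hb hd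
  have hAu2 := hA hbu hAu; have hAv2 := hA hbv hAv; have hAw2 := hA hbw hAw; have hAr2 := hA hbr hAr
  -- (w) 𝔯𝔮_u𝔮_v = (ruv, −A+l) is principal
  have Iuv : Ideal.span {(r : ℤ√m), ⟨-A, 1⟩} * Ideal.span {(u : ℤ√m), ⟨-A, 1⟩} * Ideal.span {(v : ℤ√m), ⟨-A, 1⟩} =
      Ideal.span {((r * u * v : ℤ) : ℤ√m), ⟨-A, 1⟩} := by
    rw [P hru, P (IsCoprime.mul_left hrv huv)]
  have key_w : Ideal.span {y₀} * Ideal.span {((r * u * v : ℤ) : ℤ√m), ⟨-A, 1⟩} = Ideal.span {x₀} := by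
    rw [← Iuv, ← haux]
  obtain ⟨zw, hzw, hzwd, hzwc⟩ := principal_norm_of_rel hm (mul_pos (mul_pos hr hu) hv)
    (IsCoprime.mul_dvd (IsCoprime.mul_left hrv huv) (IsCoprime.mul_dvd hru hAr2 hAu2) hAv2) hy₀ key_w
  -- (v) 𝔯𝔮_u𝔮_w: from (x₁ y₂)·𝔮_w-side… first (x₁)(y₂)𝔮_w = (x₂)(y₁)𝔮_v:
  have hvw' : Ideal.span {x₁ * y₂} * Ideal.span {(w : ℤ√m), ⟨-A, 1⟩} = Ideal.span {x₂ * y₁} * Ideal.span {(v : ℤ√m), ⟨-A, 1⟩} := by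
    rw [← Ideal.span_singleton_mul_span_singleton, ← Ideal.span_singleton_mul_span_singleton]
    calc Ideal.span {x₁} * Ideal.span {y₂} * Ideal.span {(w : ℤ√m), ⟨-A, 1⟩}
        = Ideal.span {x₁} * (Ideal.span {y₂} * Ideal.span {(w : ℤ√m), ⟨-A, 1⟩}) := by ring
      _ = Ideal.span {x₁} * (Ideal.span {x₂} * Ideal.span {(u : ℤ√m), ⟨-A, 1⟩}) := by rw [h2]
      _ = Ideal.span {x₂} * (Ideal.span {x₁} * Ideal.span {(u : ℤ√m), ⟨-A, 1⟩}) := by ring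
      _ = Ideal.span {x₂} * (Ideal.span {y₁} * Ideal.span {(v : ℤ√m), ⟨-A, 1⟩}) := by rw [h1]
      _ = Ideal.span {x₂} * Ideal.span {y₁} * Ideal.span {(v : ℤ√m), ⟨-A, 1⟩} := by ring
  -- lift to the products with 𝔯𝔮_u: (x₁y₂)·(𝔯𝔮_u𝔮_w) = (x₂y₁)·(𝔯𝔮_u𝔮_v)
  have Iuw : Ideal.span {(r : ℤ√m), ⟨-A, 1⟩} * Ideal.span {(u : ℤ√m), ⟨-A, 1⟩} * Ideal.span {(w : ℤ√m), ⟨-A, 1⟩} =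
      Ideal.span {((r * u * w : ℤ) : ℤ√m), ⟨-A, 1⟩} := by
    rw [P hru, P (IsCoprime.mul_left hrw huw)]
  have rel_vw : Ideal.span {x₁ * y₂} * Ideal.span {((r * u * w : ℤ) : ℤ√m), ⟨-A, 1⟩} =
      Ideal.span {x₂ * y₁} * Ideal.span {((r * u * v : ℤ) : ℤ√m), ⟨-A, 1⟩} := by
    rw [← Iuw, ← Iuv]
    calc Ideal.span {x₁ * y₂} * (Ideal.span {(r : ℤ√m), ⟨-A, 1⟩} * Ideal.span {(u : ℤ√m), ⟨-A, 1⟩} * Ideal.span {(w : ℤ√m), ⟨-A, 1⟩})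
        = Ideal.span {(r : ℤ√m), ⟨-A, 1⟩} * Ideal.span {(u : ℤ√m), ⟨-A, 1⟩} * (Ideal.span {x₁ * y₂} * Ideal.span {(w : ℤ√m), ⟨-A, 1⟩}) := by ring
      _ = Ideal.span {(r : ℤ√m), ⟨-A, 1⟩} * Ideal.span {(u : ℤ√m), ⟨-A, 1⟩} * (Ideal.span {x₂ * y₁} * Ideal.span {(v : ℤ√m), ⟨-A, 1⟩}) := by rw [hvw']
      _ = Ideal.span {x₂ * y₁} * (Ideal.span {(r : ℤ√m), ⟨-A, 1⟩} * Ideal.span {(u : ℤ√m), ⟨-A, 1⟩} * Ideal.span {(v : ℤ√m), ⟨-A, 1⟩}) := by ring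
  have key_v : Ideal.span {x₁ * y₂ * y₀} * Ideal.span {((r * u * w : ℤ) : ℤ√m), ⟨-A, 1⟩} = Ideal.span {x₂ * y₁ * x₀} :=
    rel_chain rel_vw key_w
  obtain ⟨zv, hzv, hzvd, hzvc⟩ := principal_norm_of_rel hm (mul_pos (mul_pos hr hu) hw)
    (IsCoprime.mul_dvd (IsCoprime.mul_left hrw huw) (IsCoprime.mul_dvd hru hAr2 hAu2) hAw2)
    (mul_ne_zero (mul_ne_zero hx₁ hy₂) hy₀) key_v
  -- (u) 𝔯𝔮_v𝔮_w: (y₁)·(𝔯𝔮_v𝔮_w) = (x₁)·(𝔯𝔮_u𝔮_w)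
  have Ivw : Ideal.span {(r : ℤ√m), ⟨-A, 1⟩} * Ideal.span {(v : ℤ√m), ⟨-A, 1⟩} * Ideal.span {(w : ℤ√m), ⟨-A, 1⟩} =
      Ideal.span {((r * v * w : ℤ) : ℤ√m), ⟨-A, 1⟩} := by
    rw [P hrv, P (IsCoprime.mul_left hrw hvw)]
  have rel_uw : Ideal.span {y₁} * Ideal.span {((r * v * w : ℤ) : ℤ√m), ⟨-A, 1⟩} =
      Ideal.span {x₁} * Ideal.span {((r * u * w : ℤ) : ℤ√m), ⟨-A, 1⟩} := by
    rw [← Ivw, ← Iuw]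
    calc Ideal.span {y₁} * (Ideal.span {(r : ℤ√m), ⟨-A, 1⟩} * Ideal.span {(v : ℤ√m), ⟨-A, 1⟩} * Ideal.span {(w : ℤ√m), ⟨-A, 1⟩})
        = Ideal.span {(r : ℤ√m), ⟨-A, 1⟩} * Ideal.span {(w : ℤ√m), ⟨-A, 1⟩} * (Ideal.span {y₁} * Ideal.span {(v : ℤ√m), ⟨-A, 1⟩}) := by ring
      _ = Ideal.span {(r : ℤ√m), ⟨-A, 1⟩} * Ideal.span {(w : ℤ√m), ⟨-A, 1⟩} * (Ideal.span {x₁} * Ideal.span {(u : ℤ√m), ⟨-A, 1⟩}) := by rw [h1]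
      _ = Ideal.span {x₁} * (Ideal.span {(r : ℤ√m), ⟨-A, 1⟩} * Ideal.span {(u : ℤ√m), ⟨-A, 1⟩} * Ideal.span {(w : ℤ√m), ⟨-A, 1⟩}) := by ring
  have key_u : Ideal.span {y₁ * (x₁ * y₂ * y₀)} * Ideal.span {((r * v * w : ℤ) : ℤ√m), ⟨-A, 1⟩} = Ideal.span {x₁ * (x₂ * y₁ * x₀)} :=
    rel_chain rel_uw key_v
  obtain ⟨zu, hzu, hzud, hzuc⟩ := principal_norm_of_rel hm (mul_pos (mul_pos hr hv) hw)
    (IsCoprime.mul_dvd (IsCoprime.mul_left hrw hvw) (IsCoprime.mul_dvd hrv hAr2 hAv2) hAw2)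
    (mul_ne_zero hy₁ (mul_ne_zero (mul_ne_zero hx₁ hy₂) hy₀)) key_u
  refine ⟨A, zu, zv, zw, ⟨by rw [hzu]; ring, hzud, hzuc⟩, ⟨by rw [hzv]; ring, hzvd, hzvc⟩, ⟨by rw [hzw]; ring, hzwd, hzwc⟩⟩

end Summit.Ventures.HSemireg.LineLawPairLaw
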